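import Literature.NumberTheory.Automorphic.FixedVectorsRankAdditive             -- ★ p852923 RANK-ADD: `finrank_fixedPoints_eq_add_of_subrepresentation`, `…_eq_of_bijective`, `map_mem_fixedPoints`
import Literature.NumberTheory.Automorphic.ConstituentsOfExtension              -- ★ `isConstituentOf_iff_of_isIrreducible`, `isIrreducible_{toRepresentation,quotientRep}_of_forall_not_lt_lt`
import Literature.NumberTheory.Automorphic.IrreducibleClassesConstituentsIsotypic -- ★ `not_isConstituentOf_of_subsingleton`
import HarnessLib

/-!
# Fixed-vector ranks of the two constituents of a length-two representation: labels by a sub∕quotient, ranks add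
# (Bernstein–Zelevinsky 1976 §2.3 «`V ↦ V^K` is exact»; Casselman 1995 §2.1, §7.1; Borel 1976 §3–§4)

Topic `NumberTheory/Automorphic`; namespace `Literature.NumberTheory.Automorphic.IrrClass` (the class-level companions of ★ `Representation.…`
in `FixedVectorsRankAdditive`).  PROOF FILE: theorems only (no definition, no instance, no notation, no named fact, no `sorry`).

For a topological group `G` and a SMOOTH complex representation `ρ` on `V : Type` whose lattice of subrepresentations has no `3`-chain
`⊥ < N₁ < N₂ < ⊤` («length at most two», the shape ★ `UnitaryGroup.U3PrincipalSeriesLengthLeTwo` delivers for the principal series of `U(3)`)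
and whose constituents (★ `IrrClass.IsConstituentOf`) are EXACTLY two distinct classes `a ≠ b` (the shape in which the tree PINS the reducible
principal series of [Rogawski1990, §12.2]: `{St_G(ψ), ψ∘det_G}`, `{π²(ξ), πⁿ(ξ)}`, the l.d.s. packets):

* §1 `finrank_fixedPoints_eq_of_mk_eq_mk` — `dim π^K` depends only on the CLASS `⟦π⟧` (transport along the `Representation.Equiv` of ★ `IrrClass.mk_eq_mk_iff`,
  ★ `finrank_fixedPoints_eq_of_bijective`); `fixedPoints_eq_bot_iff_of_mk_eq_mk` — so does «`π^K = 0`» (no finiteness needed).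
* §2 `exists_ne_bot_ne_top_of_constituents_pair` — two distinct constituents force reducibility (an irreducible `ρ` is its only constituent,
  ★ `IsConstituentOf.nonempty_equiv_of_isIrreducible`); **`exists_subrepresentation_labels_of_constituents_pair`** — without `3`-chains there is a
  `G`-stable `N` with `ρ|_N`, `ρ⁄N` irreducible and `{⟦ρ|_N⟧, ⟦ρ⁄N⟧} = {a, b}` AS A LABELLED PAIR: `(⟦ρ|_N⟧ = a ∧ ⟦ρ⁄N⟧ = b) ∨ (⟦ρ|_N⟧ = b ∧ ⟦ρ⁄N⟧ = a)`
  (★ `isConstituentOf_iff_of_isIrreducible`).  Which disjunct holds (e.g. «`St` is the quotient of `i_G(χ_St)`») is NOT decided here and is not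
  needed by the rank bookkeeping.
* §3 **`finrank_fixedPoints_add_of_constituents_pair`** — `dim a^K + dim b^K = dim ρ^K` for `K` compact with `ρ^K` finite-dimensional, for ANY
  representatives of `a`, `b` (§1 + §2 + ★ `finrank_fixedPoints_eq_add_of_subrepresentation`); the rearrangement `finrank_fixedPoints_eq_sub_of_constituents_pair`
  (`dim a^K = dim ρ^K − dim b^K`), and `finrank_fixedPoints_eq_zero_of_constituents_pair` (`dim ρ^K = 0 ⇒ dim a^K = 0`).
  Instances (datum side, not here): `dim St_G(ψ)^K = dim i_G(χ_St)^K − dim (ψ∘det_G)^K` (parahoric levels of the Steinberg constituent, [Borel1976]),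
  `dim π²(ξ)^K + dim πⁿ(ξ)^K = dim i_G(χ_ξ)^K`, `dim π¹(θ)^K + dim π²(θ)^K = dim i_B(θ̃)^K` — the Euler–Poincaré ∕ K-type bookkeeping of
  [Rogawski1990, §12.6] for every reducible principal series of [Rogawski1990, §12.2] at once.

## References
* [BernsteinZelevinsky1976] I. N. Bernstein, A. V. Zelevinsky, *Representations of the group GL(n,F) where F is a non-archimedean local field*,
  Russian Math. Surveys 31:3 (1976), §2.1–2.3 (Prop. 2.3: exactness of `V ↦ V^K`; Jordan–Hölder constituents).
* [Casselman1995] W. Casselman, *Introduction to the theory of admissible representations of 𝔭-adic reductive groups* (notes, 1995), §2.1, Cor. 7.1.2, §7.1.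
* [Borel1976] A. Borel, *Admissible representations of a semi-simple group over a local field with vectors fixed under an Iwahori subgroup*,
  Invent. Math. 35 (1976), §3–§4.
* [BushnellHenniart2006] C. Bushnell, G. Henniart, *The local Langlands conjecture for GL(2)*, Grundlehren 335 (2006), §1.1, §2 (classes, constituents).
* [Rogawski1990] J. D. Rogawski, *Automorphic Representations of Unitary Groups in Three Variables*, Ann. of Math. Stud. 123 (1990), §12.2 pp. 172–174, §12.6 p. 188.
-/

set_option autoImplicit false

noncomputable section

namespace Literature.NumberTheory.Automorphic

namespace IrrClass

universe u

variable {G : Type u} [Group G] [TopologicalSpace G]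

/-! ## §1 `dim π^K` and «`π^K = 0`» depend only on the class `⟦π⟧` -/

/-- **`dim π^K` is a class invariant**: representatives of the same class `⟦r₁⟧ = ⟦r₂⟧` have `K`-fixed subspaces of the same dimension (transport along the
`Representation.Equiv`; no topology on `K`, no finiteness). [cite: BernsteinZelevinsky1976, §2.1–2.3] [cite: BushnellHenniart2006, §1.1] -/
theorem finrank_fixedPoints_eq_of_mk_eq_mk {r₁ r₂ : SmoothIrrep G} (h : IrrClass.mk r₁ = IrrClass.mk r₂) (K : Subgroup G) :
    Module.finrank ℂ (r₁.ρ.fixedPoints K) = Module.finrank ℂ (r₂.ρ.fixedPoints K) := by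
  obtain ⟨e⟩ := (IrrClass.mk_eq_mk_iff r₁ r₂).1 h
  exact Representation.finrank_fixedPoints_eq_of_bijective e.toIntertwiningMap (EquivLike.bijective e) K

/-- **«`π^K = 0`» is a class invariant**: for `⟦r₁⟧ = ⟦r₂⟧`, `r₁^K = ⊥ ↔ r₂^K = ⊥` (an equivalence and its inverse map fixed vectors to fixed vectors,
★ `map_mem_fixedPoints`). [cite: BernsteinZelevinsky1976, §2.1–2.3] [cite: BushnellHenniart2006, §1.1] -/
theorem fixedPoints_eq_bot_iff_of_mk_eq_mk {r₁ r₂ : SmoothIrrep G} (h : IrrClass.mk r₁ = IrrClass.mk r₂) (K : Subgroup G) :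
    r₁.ρ.fixedPoints K = ⊥ ↔ r₂.ρ.fixedPoints K = ⊥ := by
  obtain ⟨e⟩ := (IrrClass.mk_eq_mk_iff r₁ r₂).1 h
  constructor
  · intro hbot
    refine (Submodule.eq_bot_iff _).2 fun v hv => ?_
    have hv' : e.symm v ∈ r₁.ρ.fixedPoints K := Representation.map_mem_fixedPoints e.symm.toIntertwiningMap K hv
    rw [hbot, Submodule.mem_bot] at hv'
    have := congrArg e hv'
    simpa using this
  · intro hbot
    refine (Submodule.eq_bot_iff _).2 fun v hv => ?_
    have hv' : e v ∈ r₂.ρ.fixedPoints K := Representation.map_mem_fixedPoints e.toIntertwiningMap K hv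
    rw [hbot, Submodule.mem_bot] at hv'
    have := congrArg e.symm hv'
    simpa using this

/-! ## §2 Two distinct constituents, no `3`-chains: the labelled sub∕quotient pair -/

/-- **Two distinct constituents force reducibility**: if the constituents of `ρ` are exactly `a ≠ b`, then `ρ` has a `G`-stable `⊥ ≠ N ≠ ⊤` — were `ρ`
irreducible (it is non-zero: a zero space has no constituent, ★ `not_isConstituentOf_of_subsingleton`), both `a` and `b` would be `⟦ρ⟧`
(★ `IsConstituentOf.nonempty_equiv_of_isIrreducible`). [cite: BushnellHenniart2006, §1.1, §2] [cite: Casselman1995, §7.1] -/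
theorem exists_ne_bot_ne_top_of_constituents_pair {V : Type} [AddCommGroup V] [Module ℂ V] {ρ : Representation ℂ G V}
    {a b : IrrClass G} (hJH : ∀ c : IrrClass G, c.IsConstituentOf ρ ↔ (c = a ∨ c = b)) (hab : a ≠ b) :
    ∃ N : Subrepresentation ρ, N ≠ ⊥ ∧ N ≠ ⊤ := by
  by_contra h
  push Not at h
  have ha : a.IsConstituentOf ρ := (hJH a).2 (Or.inl rfl)
  have hb : b.IsConstituentOf ρ := (hJH b).2 (Or.inr rfl)
  -- `V ≠ 0`: a zero space has no constituent
  haveI : Nontrivial V := by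
    by_contra hV
    haveI : Subsingleton V := not_nontrivial_iff_subsingleton.1 hV
    exact not_isConstituentOf_of_subsingleton ρ a ha
  haveI : Nontrivial (Subrepresentation ρ) := ⟨⟨⊥, ⊤, fun hbt => by
    have h' : ((⊥ : Subrepresentation ρ).toSubmodule : Submodule ℂ V) = (⊤ : Subrepresentation ρ).toSubmodule := by rw [hbt]
    exact bot_ne_top h'⟩⟩
  -- hence `ρ` is irreducible, so `a = ⟦ρ⟧ = b`
  haveI : ρ.IsIrreducible := ⟨fun N => (eq_or_ne N ⊥).elim Or.inl fun hN => Or.inr (h N hN)⟩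
  obtain ⟨ra, rfl⟩ := IrrClass.mk_surjective a
  obtain ⟨rb, rfl⟩ := IrrClass.mk_surjective b
  obtain ⟨ea⟩ := ha.nonempty_equiv_of_isIrreducible
  obtain ⟨eb⟩ := hb.nonempty_equiv_of_isIrreducible
  exact hab (IrrClass.mk_eq_mk_of_equiv (ea.trans eb.symm))

variable [SeparatelyContinuousMul G]

/-- **THE LABELLED PAIR**: for a smooth `ρ` without `3`-chains of subrepresentations whose constituents are exactly `a ≠ b`, there is a `G`-stable `N`
with `ρ|_N` and `ρ⁄N` irreducible and `(⟦ρ|_N⟧ = a ∧ ⟦ρ⁄N⟧ = b) ∨ (⟦ρ|_N⟧ = b ∧ ⟦ρ⁄N⟧ = a)` — the constituents of such a `ρ` being exactly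
`⟦ρ⁄N⟧`, `⟦ρ|_N⟧` (★ `isConstituentOf_iff_of_isIrreducible`). [cite: Casselman1995, Cor. 7.1.2, §7.1] [cite: BushnellHenniart2006, §2] [cite: BernsteinZelevinsky1976, §2.1] -/
theorem exists_subrepresentation_labels_of_constituents_pair {V : Type} [AddCommGroup V] [Module ℂ V] {ρ : Representation ℂ G V}
    (hρ : ρ.IsSmooth) (hlen : ∀ N₁ N₂ : Subrepresentation ρ, ¬ (⊥ < N₁ ∧ N₁ < N₂ ∧ N₂ < ⊤))
    {a b : IrrClass G} (hJH : ∀ c : IrrClass G, c.IsConstituentOf ρ ↔ (c = a ∨ c = b)) (hab : a ≠ b) :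
    ∃ (N : Subrepresentation ρ) (hN : N.toRepresentation.IsIrreducible) (hQ : N.quotientRep.IsIrreducible),
      (IrrClass.mk (SmoothIrrep.mk ↥N.toSubmodule N.toRepresentation hN (hρ.toRepresentation N)) = a ∧
          IrrClass.mk (SmoothIrrep.mk (V ⧸ N.toSubmodule) N.quotientRep hQ (hρ.quotientRep N)) = b) ∨
        (IrrClass.mk (SmoothIrrep.mk ↥N.toSubmodule N.toRepresentation hN (hρ.toRepresentation N)) = b ∧
          IrrClass.mk (SmoothIrrep.mk (V ⧸ N.toSubmodule) N.quotientRep hQ (hρ.quotientRep N)) = a) := by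
  obtain ⟨N, hb0, ht0⟩ := exists_ne_bot_ne_top_of_constituents_pair hJH hab
  have hN := isIrreducible_toRepresentation_of_forall_not_lt_lt hlen hb0 ht0
  have hQ := isIrreducible_quotientRep_of_forall_not_lt_lt hlen hb0 ht0
  refine ⟨N, hN, hQ, ?_⟩
  have key := isConstituentOf_iff_of_isIrreducible hρ N hN hQ
  have ha := (key a).1 ((hJH a).2 (Or.inl rfl))
  have hb := (key b).1 ((hJH b).2 (Or.inr rfl))
  rcases ha with ha | ha <;> rcases hb with hb | hb
  · exact absurd (ha.trans hb.symm) hab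
  · exact Or.inr ⟨hb.symm, ha.symm⟩
  · exact Or.inl ⟨ha.symm, hb.symm⟩
  · exact absurd (ha.trans hb.symm) hab

/-! ## §3 Ranks add on a Jordan–Hölder pair -/

variable [IsTopologicalGroup G]

/-- **RANKS ADD ON A JORDAN–HÖLDER PAIR: `dim a^K + dim b^K = dim ρ^K`** — `ρ` smooth without `3`-chains, constituents exactly `a ≠ b`, `K` compact,
`ρ^K` finite-dimensional, `r`, `r'` ANY representatives of `a`, `b`.  §2 realises `{a, b}` as `{⟦ρ|_N⟧, ⟦ρ⁄N⟧}`, §1 transports the ranks to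
`N^K`, `(ρ⁄N)^K`, and ★ `finrank_fixedPoints_eq_add_of_subrepresentation` (exactness of `V ↦ V^K`) adds them.
[cite: BernsteinZelevinsky1976, §2.3] [cite: Casselman1995, §2.1, §7.1] [cite: Borel1976, §3–§4] -/
theorem finrank_fixedPoints_add_of_constituents_pair {V : Type} [AddCommGroup V] [Module ℂ V] {ρ : Representation ℂ G V}
    (hρ : ρ.IsSmooth) (hlen : ∀ N₁ N₂ : Subrepresentation ρ, ¬ (⊥ < N₁ ∧ N₁ < N₂ ∧ N₂ < ⊤))
    {a b : IrrClass G} (hJH : ∀ c : IrrClass G, c.IsConstituentOf ρ ↔ (c = a ∨ c = b)) (hab : a ≠ b)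
    {r r' : SmoothIrrep G} (hr : IrrClass.mk r = a) (hr' : IrrClass.mk r' = b)
    {K : Subgroup G} (hKc : IsCompact (K : Set G)) [FiniteDimensional ℂ (ρ.fixedPoints K)] :
    Module.finrank ℂ (r.ρ.fixedPoints K) + Module.finrank ℂ (r'.ρ.fixedPoints K) = Module.finrank ℂ (ρ.fixedPoints K) := by
  obtain ⟨N, hN, hQ, hlab⟩ := exists_subrepresentation_labels_of_constituents_pair hρ hlen hJH hab
  have hadd := Representation.finrank_fixedPoints_eq_add_of_subrepresentation ρ hρ N hKc
  rcases hlab with ⟨hNa, hQb⟩ | ⟨hNb, hQa⟩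
  · rw [finrank_fixedPoints_eq_of_mk_eq_mk (hr.trans hNa.symm) K, finrank_fixedPoints_eq_of_mk_eq_mk (hr'.trans hQb.symm) K, hadd]
  · rw [finrank_fixedPoints_eq_of_mk_eq_mk (hr.trans hQa.symm) K, finrank_fixedPoints_eq_of_mk_eq_mk (hr'.trans hNb.symm) K, hadd, add_comm]

/-- `dim a^K = dim ρ^K − dim b^K` on a Jordan–Hölder pair (the rearrangement consumers read: `dim St_G(ψ)^K = dim i_G(χ_St)^K − dim (ψ∘det_G)^K`).
[cite: BernsteinZelevinsky1976, §2.3] [cite: Borel1976, §3–§4] [cite: Rogawski1990, §12.2 (1) p. 173] -/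
theorem finrank_fixedPoints_eq_sub_of_constituents_pair {V : Type} [AddCommGroup V] [Module ℂ V] {ρ : Representation ℂ G V}
    (hρ : ρ.IsSmooth) (hlen : ∀ N₁ N₂ : Subrepresentation ρ, ¬ (⊥ < N₁ ∧ N₁ < N₂ ∧ N₂ < ⊤))
    {a b : IrrClass G} (hJH : ∀ c : IrrClass G, c.IsConstituentOf ρ ↔ (c = a ∨ c = b)) (hab : a ≠ b)
    {r r' : SmoothIrrep G} (hr : IrrClass.mk r = a) (hr' : IrrClass.mk r' = b)
    {K : Subgroup G} (hKc : IsCompact (K : Set G)) [FiniteDimensional ℂ (ρ.fixedPoints K)] :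
    Module.finrank ℂ (r.ρ.fixedPoints K) = Module.finrank ℂ (ρ.fixedPoints K) - Module.finrank ℂ (r'.ρ.fixedPoints K) := by
  have h := finrank_fixedPoints_add_of_constituents_pair hρ hlen hJH hab hr hr' hKc
  omega

/-- `dim ρ^K = 0 ⇒ dim a^K = 0` on a Jordan–Hölder pair (e.g. «no parahoric-fixed vector in `i_G(χ)` ⇒ none in its constituents»).
[cite: BernsteinZelevinsky1976, §2.3] [cite: Borel1976, §3–§4] -/
theorem finrank_fixedPoints_eq_zero_of_constituents_pair {V : Type} [AddCommGroup V] [Module ℂ V] {ρ : Representation ℂ G V}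
    (hρ : ρ.IsSmooth) (hlen : ∀ N₁ N₂ : Subrepresentation ρ, ¬ (⊥ < N₁ ∧ N₁ < N₂ ∧ N₂ < ⊤))
    {a b : IrrClass G} (hJH : ∀ c : IrrClass G, c.IsConstituentOf ρ ↔ (c = a ∨ c = b)) (hab : a ≠ b)
    {r r' : SmoothIrrep G} (hr : IrrClass.mk r = a) (hr' : IrrClass.mk r' = b)
    {K : Subgroup G} (hKc : IsCompact (K : Set G)) [FiniteDimensional ℂ (ρ.fixedPoints K)]
    (h0 : Module.finrank ℂ (ρ.fixedPoints K) = 0) :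
    Module.finrank ℂ (r.ρ.fixedPoints K) = 0 := by
  have h := finrank_fixedPoints_add_of_constituents_pair hρ hlen hJH hab hr hr' hKc
  omega

/-- The symmetric reading: the hypotheses are symmetric in `(a, b)`, so `dim b^K + dim a^K = dim ρ^K` as well (for consumers holding the pair in the
other order). [cite: BernsteinZelevinsky1976, §2.3] -/
theorem finrank_fixedPoints_add_of_constituents_pair_symm {V : Type} [AddCommGroup V] [Module ℂ V] {ρ : Representation ℂ G V}
    (hρ : ρ.IsSmooth) (hlen : ∀ N₁ N₂ : Subrepresentation ρ, ¬ (⊥ < N₁ ∧ N₁ < N₂ ∧ N₂ < ⊤))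
    {a b : IrrClass G} (hJH : ∀ c : IrrClass G, c.IsConstituentOf ρ ↔ (c = a ∨ c = b)) (hab : a ≠ b)
    {r r' : SmoothIrrep G} (hr : IrrClass.mk r = b) (hr' : IrrClass.mk r' = a)
    {K : Subgroup G} (hKc : IsCompact (K : Set G)) [FiniteDimensional ℂ (ρ.fixedPoints K)] :
    Module.finrank ℂ (r.ρ.fixedPoints K) + Module.finrank ℂ (r'.ρ.fixedPoints K) = Module.finrank ℂ (ρ.fixedPoints K) := by
  have h := finrank_fixedPoints_add_of_constituents_pair hρ hlen hJH hab hr' hr hKc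
  omega

end IrrClass

end Literature.NumberTheory.Automorphic

end
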